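import Summits.KontsevichZagierPeriods.KontsevichZagierPeriods.Theses.SelbergAMGM
import Literature.NumberTheory.Transcendental.KZDirichletCharts

/-!
# `AMGMDirichlet` (stmt-KontsevichZagierPeriods-5624, route SelbergAMGM) — proof

For rational `a, b` and ANY two Kontsevich–Zagier integral representations on `ℝ³ = Fin 3 → ℝ`,
`r  = [{y₁, y₂ > 0, y₁^{1/3} + y₂^{1/3} < 1, y₀ ∈ (0,1)},
       6·y₁^{a−1} y₂^{b−1} (1 − y₁^{1/3} − y₂^{1/3}) · (y₀(1−y₀))^{−1/3}]` (the AM–GM base times the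
corner Beta factor) and
`r' = [(0,1)³, 54·x₀^{3a−1}(1−x₀)^{3b−1} · x₁^{3a+3b−1}(1−x₁) · (x₂(1−x₂))^{−1/3}]` (the Beta
product of the `n = 3` collapse), pinned by their domains and by their integrands ON the domains, we
prove `KZ.Equivalent r r'`.

The two classical substitutions of the planner's card — the power map `(p,q) ↦ (p³,q³)` of the open
simplex `{p,q > 0, p+q < 1}` onto the AM–GM base (`|det| = 9p²q²`) and the Dirichlet polar chart
`(s,t) ↦ (p,q) = (st, s(1−t))` of the box `(0,1)²` onto the simplex (`|det| = s`) — compose, with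
the spectator coordinate carried along (`y₀ = x₂`, a coordinate permutation folded into the chart),
to ONE `ℚ`-polynomial chart of `r.domain` by the cube `r'.domain`,
`Φ(x₀,x₁,x₂) = (x₂, (x₁x₀)³, (x₁(1−x₀))³)`, injective on the cube (positive cube roots:
`x₁ = y₁^{1/3} + y₂^{1/3}`, `x₀ = y₁^{1/3}/x₁`), onto `r.domain`, differentiable with
`|det DΦ| = 9x₁⁵x₀²(1−x₀)²`, and the Jacobian identity `r'.integrand = (r.integrand ∘ Φ)·|det DΦ|`
holds on the cube (`((st)³)^{a−1}((s(1−t))³)^{b−1}(1−s)·9s⁵t²(1−t)² · 6 =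
54·t^{3a−1}(1−t)^{3b−1}s^{3a+3b−1}(1−s)`). Hence `[r'] − [r]` is a single change-of-variables move
(Kontsevich–Zagier rule (2), `KZ.changeOfVariablesRel ⊆ KZ.relations`). Pattern of
`BetaGammaTruncated.exists_polarChart` / `KZ.exists_dirichletPolarChart` (2-dim) and of the cube
charts of `NormalFormPrinciple` (3-dim Jacobians via `Matrix.det_fin_three`). No definition is
introduced; the positivity hypotheses on `a, b` are not needed for the move (integrability is part
of the given records).

References: M. Kontsevich, D. Zagier, *Periods* (2001), §1.2 rule (2); G. E. Andrews, R. Askey,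
R. Roy, *Special Functions* (1999), Thm. 1.8.1 and §8.1 (Dirichlet / Selberg substitutions).
-/

noncomputable section

open MeasureTheory Set
open Literature.NumberTheory.Transcendental

namespace Summit.KontsevichZagierPeriods.SelbergAMGM

namespace AMGMDirichlet

/-- The real cube root of a cube: `(u³)^{1/3} = u` for `u ≥ 0`. [folklore] -/
theorem rpow_third_of_pow_three {u : ℝ} (hu : 0 ≤ u) : (u ^ 3) ^ ((1:ℝ) / 3) = u := by
  rw [← Real.rpow_natCast u 3, ← Real.rpow_mul hu]
  norm_num

/-- **The Jacobian identity of the composite chart.** For `s > 0`, `0 < t < 1` and any spectator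
factor `C`:
`54·t^{3a−1}(1−t)^{3b−1}s^{3a+3b−1}(1−s)·C
  = 6·((st)³)^{a−1}((s(1−t))³)^{b−1}(1 − ((st)³)^{1/3} − ((s(1−t))³)^{1/3})·C · |9s⁵t²(1−t)²|`
(cube roots of cubes, `(uv)^e = u^e v^e` for nonnegative bases, and
`s^{3(a−1)} s^{3(b−1)} s⁵ = s^{3a+3b−1}`, `t^{3(a−1)} t² = t^{3a−1}`). [folklore] -/
theorem jacobian_identity (a b C : ℝ) {s t : ℝ} (hs : 0 < s) (ht : 0 < t) (ht1 : t < 1) :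
    54 * t ^ (3 * a - 1) * (1 - t) ^ (3 * b - 1) * s ^ (3 * a + 3 * b - 1) * (1 - s) * C =
      6 * ((s * t) ^ 3) ^ (a - 1) * ((s * (1 - t)) ^ 3) ^ (b - 1) *
        (1 - ((s * t) ^ 3) ^ ((1:ℝ) / 3) - ((s * (1 - t)) ^ 3) ^ ((1:ℝ) / 3)) * C *
        |9 * s ^ 5 * t ^ 2 * (1 - t) ^ 2| := by
  have h1t : 0 < 1 - t := sub_pos.2 ht1
  have hst : 0 ≤ s * t := (mul_pos hs ht).le
  have hs1t : 0 ≤ s * (1 - t) := (mul_pos hs h1t).le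
  -- a real power of a cube: `(u³)^e = u^{3e}` for `u ≥ 0`
  have h3 : ∀ u : ℝ, 0 ≤ u → ∀ e : ℝ, (u ^ 3) ^ e = u ^ (3 * e) := by
    intro u hu e
    rw [← Real.rpow_natCast u 3, ← Real.rpow_mul hu]
    norm_num
  rw [rpow_third_of_pow_three hst, rpow_third_of_pow_three hs1t, h3 _ hst, h3 _ hs1t,
    Real.mul_rpow hs.le ht.le, Real.mul_rpow hs.le h1t.le, abs_of_pos (by positivity)]
  have es : s ^ (3 * a + 3 * b - 1) = s ^ (3 * (a - 1)) * s ^ (3 * (b - 1)) * s ^ 5 := by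
    rw [← Real.rpow_natCast s 5, ← Real.rpow_add hs, ← Real.rpow_add hs]
    congr 1
    push_cast
    ring
  have et : t ^ (3 * a - 1) = t ^ (3 * (a - 1)) * t ^ 2 := by
    rw [← Real.rpow_natCast t 2, ← Real.rpow_add ht]
    congr 1
    push_cast
    ring
  have e1t : (1 - t) ^ (3 * b - 1) = (1 - t) ^ (3 * (b - 1)) * (1 - t) ^ 2 := by
    rw [← Real.rpow_natCast (1 - t) 2, ← Real.rpow_add h1t]
    congr 1
    push_cast
    ring
  rw [es, et, e1t]
  ring

/-- **The composite chart `Φ(x₀,x₁,x₂) = (x₂, (x₁x₀)³, (x₁(1−x₀))³)`** of the AM–GM base times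
`(0,1)` by the open unit cube (Dirichlet polar chart, then coordinatewise cubes, spectator `x₂`
moved to the front): a `ℚ`-polynomial (hence `ℚ`-semialgebraic) map, differentiable everywhere with
`det DΦ(x) = 9x₁⁵x₀²(1−x₀)²`, injective on the cube (positive cube roots) and ONTO
`{y₁, y₂ > 0, y₁^{1/3} + y₂^{1/3} < 1, y₀ ∈ (0,1)}` (inverse `x₂ = y₀`,
`x₁ = y₁^{1/3} + y₂^{1/3}`, `x₀ = y₁^{1/3}/x₁`). [folklore] -/
theorem exists_chart :
    ∃ (Φ : (Fin 3 → ℝ) → (Fin 3 → ℝ)) (Φ' : (Fin 3 → ℝ) → (Fin 3 → ℝ) →L[ℝ] (Fin 3 → ℝ)),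
      (∀ x, Φ x 0 = x 2) ∧ (∀ x, Φ x 1 = (x 1 * x 0) ^ 3) ∧
      (∀ x, Φ x 2 = (x 1 * (1 - x 0)) ^ 3) ∧
      IsSemialgebraicMapOn ℚ {x : Fin 3 → ℝ | ∀ i, x i ∈ Set.Ioo (0:ℝ) 1} Φ ∧
      (∀ x, HasFDerivAt Φ (Φ' x) x) ∧
      (∀ x, (Φ' x).det = 9 * x 1 ^ 5 * x 0 ^ 2 * (1 - x 0) ^ 2) ∧
      Set.InjOn Φ {x : Fin 3 → ℝ | ∀ i, x i ∈ Set.Ioo (0:ℝ) 1} ∧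
      Φ '' {x : Fin 3 → ℝ | ∀ i, x i ∈ Set.Ioo (0:ℝ) 1} =
        {y | 0 < y 1 ∧ 0 < y 2 ∧ (y 1) ^ ((1:ℝ) / 3) + (y 2) ^ ((1:ℝ) / 3) < 1 ∧
          y 0 ∈ Set.Ioo (0:ℝ) 1} := by
  set Φ : (Fin 3 → ℝ) → (Fin 3 → ℝ) := fun x => ![x 2, (x 1 * x 0) ^ 3, (x 1 * (1 - x 0)) ^ 3]
  set Φ' : (Fin 3 → ℝ) → (Fin 3 → ℝ) →L[ℝ] (Fin 3 → ℝ) := fun x =>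
    LinearMap.toContinuousLinearMap
      (Matrix.toLin' !![(0:ℝ), 0, 1; 3 * x 1 ^ 3 * x 0 ^ 2, 3 * x 1 ^ 2 * x 0 ^ 3, 0;
        -(3 * x 1 ^ 3 * (1 - x 0) ^ 2), 3 * x 1 ^ 2 * (1 - x 0) ^ 3, 0])
  have hΦ0 : ∀ x, Φ x 0 = x 2 := fun x => rfl
  have hΦ1 : ∀ x, Φ x 1 = (x 1 * x 0) ^ 3 := fun x => rfl
  have hΦ2 : ∀ x, Φ x 2 = (x 1 * (1 - x 0)) ^ 3 := fun x => rfl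
  have hΦ'0 : ∀ x v : Fin 3 → ℝ, Φ' x v 0 = v 2 := by
    intro x v
    change Matrix.toLin' !![(0:ℝ), 0, 1; 3 * x 1 ^ 3 * x 0 ^ 2, 3 * x 1 ^ 2 * x 0 ^ 3, 0;
      -(3 * x 1 ^ 3 * (1 - x 0) ^ 2), 3 * x 1 ^ 2 * (1 - x 0) ^ 3, 0] v 0 = _
    rw [Matrix.toLin'_apply]
    simp [Matrix.mulVec, dotProduct, Fin.sum_univ_three]
  have hΦ'1 : ∀ x v : Fin 3 → ℝ,
      Φ' x v 1 = 3 * x 1 ^ 3 * x 0 ^ 2 * v 0 + 3 * x 1 ^ 2 * x 0 ^ 3 * v 1 := by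
    intro x v
    change Matrix.toLin' !![(0:ℝ), 0, 1; 3 * x 1 ^ 3 * x 0 ^ 2, 3 * x 1 ^ 2 * x 0 ^ 3, 0;
      -(3 * x 1 ^ 3 * (1 - x 0) ^ 2), 3 * x 1 ^ 2 * (1 - x 0) ^ 3, 0] v 1 = _
    rw [Matrix.toLin'_apply]
    simp [Matrix.mulVec, dotProduct, Fin.sum_univ_three]
  have hΦ'2 : ∀ x v : Fin 3 → ℝ,
      Φ' x v 2 = -(3 * x 1 ^ 3 * (1 - x 0) ^ 2) * v 0 + 3 * x 1 ^ 2 * (1 - x 0) ^ 3 * v 1 := by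
    intro x v
    change Matrix.toLin' !![(0:ℝ), 0, 1; 3 * x 1 ^ 3 * x 0 ^ 2, 3 * x 1 ^ 2 * x 0 ^ 3, 0;
      -(3 * x 1 ^ 3 * (1 - x 0) ^ 2), 3 * x 1 ^ 2 * (1 - x 0) ^ 3, 0] v 2 = _
    rw [Matrix.toLin'_apply]
    simp [Matrix.mulVec, dotProduct, Fin.sum_univ_three]
  have hdet : ∀ x, (Φ' x).det = 9 * x 1 ^ 5 * x 0 ^ 2 * (1 - x 0) ^ 2 := by
    intro x
    change LinearMap.det (Matrix.toLin' !![(0:ℝ), 0, 1;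
      3 * x 1 ^ 3 * x 0 ^ 2, 3 * x 1 ^ 2 * x 0 ^ 3, 0;
      -(3 * x 1 ^ 3 * (1 - x 0) ^ 2), 3 * x 1 ^ 2 * (1 - x 0) ^ 3, 0]) = _
    rw [LinearMap.det_toLin', Matrix.det_fin_three]
    simp only [Matrix.of_apply, Matrix.cons_val', Matrix.cons_val_zero, Matrix.cons_val_one,
      Matrix.cons_val_two, Matrix.empty_val', Matrix.cons_val_fin_one, Matrix.head_cons,
      Matrix.tail_cons, Matrix.head_fin_const]
    ring
  have hderiv : ∀ x, HasFDerivAt Φ (Φ' x) x := by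
    intro x
    have h0 : HasFDerivAt (fun y : Fin 3 → ℝ => y 0)
        (ContinuousLinearMap.proj (R := ℝ) (φ := fun _ : Fin 3 => ℝ) 0) x := hasFDerivAt_apply 0 x
    have h1 : HasFDerivAt (fun y : Fin 3 → ℝ => y 1)
        (ContinuousLinearMap.proj (R := ℝ) (φ := fun _ : Fin 3 => ℝ) 1) x := hasFDerivAt_apply 1 x
    have h2 : HasFDerivAt (fun y : Fin 3 → ℝ => y 2)
        (ContinuousLinearMap.proj (R := ℝ) (φ := fun _ : Fin 3 => ℝ) 2) x := hasFDerivAt_apply 2 x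
    rw [hasFDerivAt_pi']
    refine Fin.forall_fin_succ.2 ⟨?_, Fin.forall_fin_two.2 ⟨?_, ?_⟩⟩
    · show HasFDerivAt (fun y : Fin 3 → ℝ => y 2) _ x
      refine h2.congr_fderiv (ContinuousLinearMap.ext fun v => ?_)
      show v 2 = Φ' x v 0
      rw [hΦ'0]
    · show HasFDerivAt (fun y : Fin 3 → ℝ => (y 1 * y 0) ^ 3) _ x
      refine ((h1.mul h0).pow 3).congr_fderiv (ContinuousLinearMap.ext fun v => ?_)
      show _ = Φ' x v 1
      rw [hΦ'1]
      simp
      ring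
    · show HasFDerivAt (fun y : Fin 3 → ℝ => (y 1 * (1 - y 0)) ^ 3) _ x
      refine ((h1.mul (h0.const_sub 1)).pow 3).congr_fderiv (ContinuousLinearMap.ext fun v => ?_)
      show _ = Φ' x v 2
      rw [hΦ'2]
      simp
      ring
  refine ⟨Φ, Φ', hΦ0, hΦ1, hΦ2, ?_, hderiv, hdet, ?_, ?_⟩
  · -- a `ℚ`-polynomial map is `ℚ`-semialgebraic
    convert isSemialgebraicMapOn_aeval (KZ.isSemialgebraic_box 3)
      ![(MvPolynomial.X 2 : MvPolynomial (Fin 3) ℚ), (MvPolynomial.X 1 * MvPolynomial.X 0) ^ 3,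
        (MvPolynomial.X 1 * (1 - MvPolynomial.X 0)) ^ 3] using 2 with x
    funext i
    fin_cases i
    · simp [hΦ0]
    · simp [hΦ1]
    · simp [hΦ2]
  · -- injective on the cube: positive cube roots are unique
    intro x hx y hy hxy
    have e0 : x 2 = y 2 := congrFun hxy 0
    have e1 : (x 1 * x 0) ^ 3 = (y 1 * y 0) ^ 3 := congrFun hxy 1
    have e2 : (x 1 * (1 - x 0)) ^ 3 = (y 1 * (1 - y 0)) ^ 3 := congrFun hxy 2
    rw [pow_left_inj₀ (mul_pos (hx 1).1 (hx 0).1).le (mul_pos (hy 1).1 (hy 0).1).le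
      (by norm_num)] at e1
    rw [pow_left_inj₀ (mul_pos (hx 1).1 (sub_pos.2 (hx 0).2)).le
      (mul_pos (hy 1).1 (sub_pos.2 (hy 0).2)).le (by norm_num)] at e2
    have h1 : x 1 = y 1 := by linear_combination e1 + e2
    rw [h1] at e1
    have h0 : x 0 = y 0 := mul_left_cancel₀ (hy 1).1.ne' e1
    funext i
    fin_cases i
    · exact h0
    · exact h1
    · exact e0
  · -- onto the AM–GM base times `(0,1)`
    ext y
    constructor
    · rintro ⟨x, hx, rfl⟩
      have hp : 0 < x 1 * x 0 := mul_pos (hx 1).1 (hx 0).1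
      have hq : 0 < x 1 * (1 - x 0) := mul_pos (hx 1).1 (sub_pos.2 (hx 0).2)
      refine ⟨?_, ?_, ?_, ?_⟩
      · show 0 < (x 1 * x 0) ^ 3
        positivity
      · show 0 < (x 1 * (1 - x 0)) ^ 3
        positivity
      · show ((x 1 * x 0) ^ 3) ^ ((1:ℝ) / 3) + ((x 1 * (1 - x 0)) ^ 3) ^ ((1:ℝ) / 3) < 1
        rw [rpow_third_of_pow_three hp.le, rpow_third_of_pow_three hq.le]
        have e : x 1 * x 0 + x 1 * (1 - x 0) = x 1 := by ring
        rw [e]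
        exact (hx 1).2
      · show x 2 ∈ Set.Ioo (0:ℝ) 1
        exact hx 2
    · rintro ⟨hy1, hy2, hsum, hy0⟩
      -- the cube of a real cube root: `(u^{1/3})³ = u` for `u ≥ 0`
      have hcube : ∀ u : ℝ, 0 ≤ u → (u ^ ((1:ℝ) / 3)) ^ 3 = u := by
        intro u hu
        rw [← Real.rpow_natCast _ 3, ← Real.rpow_mul hu]
        norm_num
      have hp : 0 < (y 1) ^ ((1:ℝ) / 3) := Real.rpow_pos_of_pos hy1 _
      have hq : 0 < (y 2) ^ ((1:ℝ) / 3) := Real.rpow_pos_of_pos hy2 _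
      have hs : 0 < (y 1) ^ ((1:ℝ) / 3) + (y 2) ^ ((1:ℝ) / 3) := add_pos hp hq
      refine ⟨![(y 1) ^ ((1:ℝ) / 3) / ((y 1) ^ ((1:ℝ) / 3) + (y 2) ^ ((1:ℝ) / 3)),
        (y 1) ^ ((1:ℝ) / 3) + (y 2) ^ ((1:ℝ) / 3), y 0], ?_, ?_⟩
      · refine Fin.forall_fin_succ.2 ⟨?_, Fin.forall_fin_two.2 ⟨⟨hs, hsum⟩, hy0⟩⟩
        exact ⟨div_pos hp hs, (div_lt_one hs).2 (by linarith)⟩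
      · refine funext (Fin.forall_fin_succ.2 ⟨rfl, Fin.forall_fin_two.2 ⟨?_, ?_⟩⟩)
        · show (((y 1) ^ ((1:ℝ) / 3) + (y 2) ^ ((1:ℝ) / 3)) *
              ((y 1) ^ ((1:ℝ) / 3) / ((y 1) ^ ((1:ℝ) / 3) + (y 2) ^ ((1:ℝ) / 3)))) ^ 3 = y 1
          rw [mul_div_cancel₀ _ hs.ne']
          exact hcube _ hy1.le
        · show (((y 1) ^ ((1:ℝ) / 3) + (y 2) ^ ((1:ℝ) / 3)) *
              (1 - (y 1) ^ ((1:ℝ) / 3) / ((y 1) ^ ((1:ℝ) / 3) + (y 2) ^ ((1:ℝ) / 3)))) ^ 3 = y 2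
          have e : ((y 1) ^ ((1:ℝ) / 3) + (y 2) ^ ((1:ℝ) / 3)) *
              (1 - (y 1) ^ ((1:ℝ) / 3) / ((y 1) ^ ((1:ℝ) / 3) + (y 2) ^ ((1:ℝ) / 3))) =
              (y 2) ^ ((1:ℝ) / 3) := by
            field_simp
            ring
          rw [e]
          exact hcube _ hy2.le

end AMGMDirichlet

/-- **`AMGMDirichlet`** (route SelbergAMGM, stmt-KontsevichZagierPeriods-5624): for rational `a, b`
(`> 0`), any representation
`r = [{y₁,y₂ > 0, y₁^{1/3}+y₂^{1/3} < 1, y₀ ∈ (0,1)}, 6y₁^{a−1}y₂^{b−1}(1−y₁^{1/3}−y₂^{1/3})(y₀(1−y₀))^{−1/3}]`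
is equivalent in the Kontsevich–Zagier calculus to any representation
`r' = [(0,1)³, 54x₀^{3a−1}(1−x₀)^{3b−1}x₁^{3a+3b−1}(1−x₁)(x₂(1−x₂))^{−1/3}]` — by ONE change of
variables along the composite polynomial chart `Φ(x₀,x₁,x₂) = (x₂, (x₁x₀)³, (x₁(1−x₀))³)` (the
Dirichlet polar chart `(s,t) ↦ (st, s(1−t))` followed by the cube map `(p,q) ↦ (p³,q³)`, spectator
carried along; `|det DΦ| = 9x₁⁵x₀²(1−x₀)²`; `[r'] − [r] ∈ KZ.changeOfVariablesRel`).
[cite: KontsevichZagier2001, §1.2 rule (2)] -/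
theorem amgmDirichlet_proof :
    Summit.KontsevichZagierPeriods.KontsevichZagierPeriods.Theses.SelbergAMGM.AMGMDirichlet := by
  intro a b _ _ r r' hrd hri hr'd hr'i
  obtain ⟨Φ, Φ', hΦ0, hΦ1, hΦ2, hsa, hderiv, hdet, hinj, himage⟩ := AMGMDirichlet.exists_chart
  -- the move `[r'] − [r]`: source the cube `r'`, target `r = Φ(r')`
  have hmem : KZ.of r' - KZ.of r ∈ KZ.changeOfVariablesRel := by
    refine ⟨3, r', r, Φ, Φ', by rw [hr'd]; exact hsa, fun x _ => (hderiv x).hasFDerivWithinAt,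
      by rw [hr'd]; exact hinj, by rw [hr'd, hrd, himage], fun x hx => ?_, rfl⟩
    -- the Jacobian identity on the cube
    have hx' : ∀ i, x i ∈ Set.Ioo (0:ℝ) 1 := by rw [hr'd] at hx; exact hx
    have hΦx : Φ x ∈ r.domain := by
      rw [hrd, ← himage]
      exact mem_image_of_mem Φ hx'
    rw [hr'i hx, hri hΦx, hdet x]
    simp only [hΦ0, hΦ1, hΦ2]
    exact AMGMDirichlet.jacobian_identity (a : ℝ) (b : ℝ) _ (hx' 1).1 (hx' 0).1 (hx' 0).2
  exact KZ.Equivalent.symm (KZ.changeOfVariablesRel_subset_relations hmem)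

end Summit.KontsevichZagierPeriods.SelbergAMGM

end
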